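import Summits.QuantumFields.YangMills.Theorems.BalabanLadderIRPinnedExitRateForm
import HarnessLib

/-!
# Crux `BalabanLadder.IR` ∕ `IRcof` (stmt-QuantumFields-19354 ∕ 26930): THE NUMBER as a UNIFORM LIMIT —
# PX(1/24) ↔ «δᶜ_β(⌈T/a(β)⌉₊) → 0 as T → ∞, UNIFORMLY in β on a ray [β₁, ∞)»;  PXcof(1/24) ↔ «… uniformly on SOME coupling set unbounded above»
# (helper; LEAD prover ym-ir-line-ab-p1 gen 7, slot custody; def-free)

HONEST STATUS.  Topological re-typing of the landed rate ∕ designated faces (`BalabanLadderIRPinnedExitRateForm`, p658673); nothing here proves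
PX(1/24), PXcof(1/24) (THE NUMBER), `BalabanLadder.IR` (19354), `IRcof` (26930), or the Clay Yang–Mills mass gap (NOT proved anywhere in this
tree; R4 = the conditional finite-𝕋⁴ rung `BalabanLadder.UV` only).  Width 0 toward the stubs.

With the ONE-BOX PURITY PROFILE `F T β := coldDefect r.ρ β ⌈T/a(β)⌉₊` (the cold `4:1` box of physical side `T` at coupling `β`; spelled inline, no definition):

* `pinnedExitAt24_iff_tendstoUniformlyOn` — **PX(1/24) ↔ `∃ β₁, TendstoUniformlyOn F 0 atTop (Set.Ici β₁)`**: the purity defect of the box of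
  physical side `T` tends to `0` as `T → ∞`, UNIFORMLY IN THE COUPLING beyond one threshold.  This is THE NUMBER in the form in which «vacuum dominance
  at large physical volume survives the continuum limit» is usually SAID (Mathlib's `TendstoUniformlyOn`, metric form `∀ ε > 0, ∀ᶠ T, ∀ β ≥ β₁, |F T β| < ε`).
* `pinnedExitsCofinalAt24_iff_tendstoUniformlyOn` — **PXcof(1/24) (26930 slot, body verbatim) ↔ `∃ S : Set ℝ, (∀ x, ∃ β ∈ S, x ≤ β) ∧ TendstoUniformlyOn F 0 atTop S`**:
  the same uniform limit along SOME set of couplings unbounded above — literally the «`Bset` unbounded above» binder of the re-typed leaf `IRcof` itself,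
  now on the partition-function side.
* Engine (model side, one coupling): `abs_lt_of_rate` — the rate law `δ ≤ exp(−c·s·P)` on `s·P ≥ T₁` with `0 ≤ β`, `0 < s ≤ 1`, `T ≥ max T₁ (max 8 (−log ε ∕ c + 1))`
  gives `|F T β| < ε` (non-negativity of the cold defect from the tree's `DoublingDefect.coldDefect_nonneg`, `⌈T/s⌉₊ ≥ 8`).

READING.  19354 and 26930 on the simply-connected half = ONE uniform-limit statement, on a RAY of couplings versus on an UNBOUNDED SET of couplings.
No new definition; constants explicit; the floor `LowerBounds` carried, not used.

References: tree `BalabanLadderIRPinnedExitRateForm`, `BalabanLadderIRPinnedExitFilterForm` (LEAD g7), `DoublingDefectRecursionToGapSpectral`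
(`coldDefect_nonneg`); Mathlib `Metric.tendstoUniformlyOn_iff`.
-/

noncomputable section

open Filter Topology
open Literature.MathematicalPhysics.QuantumFieldTheory
open Summit.QuantumFields.YangMills.Cruxes.OSLegsFromFemtoAndGap.DlrCollarTransfer (LowerBounds)
open Summit.QuantumFields.YangMills.Cruxes.IR.ColdPurityBridge (coldDefect)
open Summit.QuantumFields.YangMills.Cruxes.IR.PinnedExit96 (PinnedExitAt)
open Summit.QuantumFields.YangMills.Theorems.DoublingDefect (coldDefect_nonneg)

namespace Summit.QuantumFields.YangMills.Cruxes.IR.PinnedExit96.RateForm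

/-! ## §1 Model side: the rate law makes the one-box profile uniformly small -/

section Model

variable {G : Type} [Group G] [TopologicalSpace G] [IsTopologicalGroup G] [CompactSpace G]
  [MeasurableSpace G] [BorelSpace G]

/-- The cold defect of a box of side `L ≥ 8` at `β ≥ 0` is non-negative (tree `DoublingDefect.coldDefect_nonneg`, `t = ⌊L/4⌋ ≥ 2`). -/
theorem coldDefect_nonneg_of_le (r : LatticeRep G) {β : ℝ} (hβ0 : 0 ≤ β) {L : ℕ} (hL : 8 ≤ L) :
    0 ≤ coldDefect r.ρ β L := by
  haveI : SecondCountableTopology G :=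
    (r.continuous.isClosedEmbedding r.injective).isEmbedding.secondCountableTopology
  haveI : NeZero L := ⟨by omega⟩
  exact coldDefect_nonneg r.continuous r.mem_unitary hβ0 L (L / 4) (by omega)

/-- **Engine (PROVED, model side).**  At one coupling `β ≥ 0` with floor scale `0 < s ≤ 1`: the rate law `δᶜ_β(P) ≤ exp(−c·s·P)` on `s·P ≥ T₁` (`c > 0`)
gives `|δᶜ_β(⌈T/s⌉₊)| < ε` for every `T ≥ max T₁ (max 8 (−log ε ∕ c + 1))`. -/
theorem abs_lt_of_rate (r : LatticeRep G) {β s T₁ c ε T : ℝ} (hβ0 : 0 ≤ β) (hs : 0 < s) (hs1 : s ≤ 1) (hc : 0 < c) (hε : 0 < ε)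
    (hrate : ∀ P : ℕ, T₁ ≤ s * (P : ℝ) → coldDefect r.ρ β P ≤ Real.exp (-(c * (s * (P : ℝ)))))
    (hT : max T₁ (max 8 (-Real.log ε / c + 1)) ≤ T) :
    |coldDefect r.ρ β ⌈T / s⌉₊| < ε := by
  have hT1 : T₁ ≤ T := (le_max_left _ _).trans hT
  have hT8 : (8 : ℝ) ≤ T := ((le_max_left _ _).trans (le_max_right _ _)).trans hT
  have hTl : -Real.log ε / c + 1 ≤ T := ((le_max_right _ _).trans (le_max_right _ _)).trans hT
  have hceil : T ≤ s * ((⌈T / s⌉₊ : ℕ) : ℝ) := le_mul_ceil_div hs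
  have hP8 : 8 ≤ ⌈T / s⌉₊ := by
    have h1 : (8 : ℝ) ≤ T / s := by
      rw [le_div_iff₀ hs]; nlinarith
    exact_mod_cast h1.trans (Nat.le_ceil _)
  have hnn : 0 ≤ coldDefect r.ρ β ⌈T / s⌉₊ := coldDefect_nonneg_of_le r hβ0 hP8
  rw [abs_of_nonneg hnn]
  refine lt_of_le_of_lt (hrate _ (hT1.trans hceil)) ?_
  have hlt : -Real.log ε < c * (s * ((⌈T / s⌉₊ : ℕ) : ℝ)) := by
    have h1 : -Real.log ε < c * T := by
      have : -Real.log ε / c < T := by linarith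
      rwa [div_lt_iff₀ hc, mul_comm] at this
    exact lt_of_lt_of_le h1 (mul_le_mul_of_nonneg_left hceil hc.le)
  calc Real.exp (-(c * (s * ((⌈T / s⌉₊ : ℕ) : ℝ)))) < Real.exp (Real.log ε) := Real.exp_lt_exp.2 (by linarith)
    _ = ε := Real.exp_log hε

end Model

/-! ## §2 PX(1/24): uniform limit on a ray of couplings -/

/-- **PX(1/24) ↔ UNIFORM LIMIT ON A RAY (PROVED).**  THE NUMBER holds iff, under the crux's own hypotheses, there is a coupling threshold `β₁` such that
`coldDefect r.ρ β ⌈T/a(β)⌉₊ → 0` as `T → ∞` UNIFORMLY in `β ∈ [β₁, ∞)`. -/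
theorem pinnedExitAt24_iff_tendstoUniformlyOn :
    PinnedExitAt (1 / 24) ↔
    ∀ (G : Type) [Group G] [TopologicalSpace G] [IsTopologicalGroup G] [CompactSpace G],
      IsCompactSimpleLieGroup G → SimplyConnectedSpace G →
      letI : MeasurableSpace G := borel G
      haveI : BorelSpace G := ⟨rfl⟩
      ∀ (r : LatticeRep G) (a : ℝ → ℝ), (∀ β, 0 < a β) → Tendsto a atTop (𝓝 0) → LowerBounds G r a →
        ∃ β₁ : ℝ, TendstoUniformlyOn (fun (T : ℝ) (β : ℝ) => coldDefect r.ρ β ⌈T / a β⌉₊) (fun _ => (0 : ℝ))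
          atTop (Set.Ici β₁) := by
  constructor
  · intro hP G _ _ _ _ hG hsc
    letI : MeasurableSpace G := borel G
    haveI : BorelSpace G := ⟨rfl⟩
    intro r a ha ha0 hlb
    obtain ⟨T₁, c, β₁, hc, hrate⟩ := rateForm_of_pinnedExitAt24 hP G hG hsc r a ha ha0 hlb
    obtain ⟨βa, hβa⟩ := eventually_le_of_tendsto_zero ha0 one_pos
    refine ⟨max (max β₁ βa) 0, Metric.tendstoUniformlyOn_iff.2 fun ε hε => ?_⟩
    refine Filter.eventually_atTop.2 ⟨max T₁ (max 8 (-Real.log ε / c + 1)), fun T hT β hβ => ?_⟩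
    have hβ1 : β₁ ≤ β := (le_max_left _ _).trans ((le_max_left _ _).trans hβ)
    have hβa' : βa ≤ β := (le_max_right _ _).trans ((le_max_left _ _).trans hβ)
    have hβ0 : (0 : ℝ) ≤ β := (le_max_right _ _).trans hβ
    rw [Real.dist_eq, zero_sub, abs_neg]
    exact abs_lt_of_rate r hβ0 (ha β) (hβa β hβa') hc hε (hrate β hβ1) hT
  · intro hU
    refine pinnedExitAt24_of_designated fun G _ _ _ _ hG hsc => ?_
    letI : MeasurableSpace G := borel G
    haveI : BorelSpace G := ⟨rfl⟩
    intro r a ha ha0 hlb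
    obtain ⟨β₁, hunif⟩ := hU G hG hsc r a ha ha0 hlb
    have hev := (Metric.tendstoUniformlyOn_iff.1 hunif) (1 / 24) (by norm_num)
    obtain ⟨T, hT, hT1⟩ := (hev.and (Filter.eventually_ge_atTop 1)).exists
    refine ⟨T, β₁, by linarith, fun β hβ => ?_⟩
    have h := hT β (Set.mem_Ici.2 hβ)
    rw [Real.dist_eq, zero_sub, abs_neg] at h
    exact (le_abs_self _).trans h.le

/-! ## §3 PXcof(1/24): uniform limit on an unbounded set of couplings -/

/-- **PXcof(1/24) ↔ UNIFORM LIMIT ON AN UNBOUNDED COUPLING SET (PROVED)** (cofinal body spelled verbatim): there is `S ⊆ ℝ` unbounded above with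
`coldDefect r.ρ β ⌈T/a(β)⌉₊ → 0` as `T → ∞` uniformly in `β ∈ S` — the «`Bset` unbounded above» binder of `IRcof`, partition-function side. -/
theorem pinnedExitsCofinalAt24_iff_tendstoUniformlyOn :
    (∀ (G : Type) [Group G] [TopologicalSpace G] [IsTopologicalGroup G] [CompactSpace G],
      IsCompactSimpleLieGroup G → SimplyConnectedSpace G →
      letI : MeasurableSpace G := borel G
      haveI : BorelSpace G := ⟨rfl⟩
      ∀ (r : LatticeRep G) (a : ℝ → ℝ), (∀ β, 0 < a β) → Tendsto a atTop (𝓝 0) → LowerBounds G r a →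
        ∃ T : ℝ, ∀ β₁ : ℝ, ∃ β : ℝ, β₁ ≤ β ∧ ∃ L : ℕ, 8 ≤ L ∧ a β * (L : ℝ) ≤ T ∧ coldDefect r.ρ β L ≤ 1 / 24) ↔
    ∀ (G : Type) [Group G] [TopologicalSpace G] [IsTopologicalGroup G] [CompactSpace G],
      IsCompactSimpleLieGroup G → SimplyConnectedSpace G →
      letI : MeasurableSpace G := borel G
      haveI : BorelSpace G := ⟨rfl⟩
      ∀ (r : LatticeRep G) (a : ℝ → ℝ), (∀ β, 0 < a β) → Tendsto a atTop (𝓝 0) → LowerBounds G r a →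
        ∃ S : Set ℝ, (∀ x : ℝ, ∃ β ∈ S, x ≤ β) ∧
          TendstoUniformlyOn (fun (T : ℝ) (β : ℝ) => coldDefect r.ρ β ⌈T / a β⌉₊) (fun _ => (0 : ℝ)) atTop S := by
  rw [pinnedExitsCofinalAt24_iff_rateForm]
  constructor
  · intro hR G _ _ _ _ hG hsc
    letI : MeasurableSpace G := borel G
    haveI : BorelSpace G := ⟨rfl⟩
    intro r a ha ha0 hlb
    obtain ⟨T₁, c, hc, hrate⟩ := hR G hG hsc r a ha ha0 hlb
    obtain ⟨βa, hβa⟩ := eventually_le_of_tendsto_zero ha0 one_pos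
    -- the good couplings: non-negative, unit scale ≤ 1, rate law at `β`
    refine ⟨{β : ℝ | 0 ≤ β ∧ a β ≤ 1 ∧ ∀ P : ℕ, T₁ ≤ a β * (P : ℝ) →
        coldDefect r.ρ β P ≤ Real.exp (-(c * (a β * (P : ℝ))))}, fun x => ?_, ?_⟩
    · obtain ⟨β, hβ, hrb⟩ := hrate (max x (max βa 0))
      exact ⟨β, ⟨(le_max_right _ _).trans ((le_max_right _ _).trans hβ),
        hβa β ((le_max_left _ _).trans ((le_max_right _ _).trans hβ)), hrb⟩, (le_max_left _ _).trans hβ⟩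
    · refine Metric.tendstoUniformlyOn_iff.2 fun ε hε => ?_
      refine Filter.eventually_atTop.2 ⟨max T₁ (max 8 (-Real.log ε / c + 1)), fun T hT β hβ => ?_⟩
      obtain ⟨hβ0, hβ1, hrb⟩ := hβ
      rw [Real.dist_eq, zero_sub, abs_neg]
      exact abs_lt_of_rate r hβ0 (ha β) hβ1 hc hε hrb hT
  · intro hU
    -- go through the cofinal designated-box face
    have hD : ∀ (G : Type) [Group G] [TopologicalSpace G] [IsTopologicalGroup G] [CompactSpace G],
        IsCompactSimpleLieGroup G → SimplyConnectedSpace G →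
        letI : MeasurableSpace G := borel G
        haveI : BorelSpace G := ⟨rfl⟩
        ∀ (r : LatticeRep G) (a : ℝ → ℝ), (∀ β, 0 < a β) → Tendsto a atTop (𝓝 0) → LowerBounds G r a →
          ∃ T : ℝ, 0 < T ∧ ∀ β₁ : ℝ, ∃ β : ℝ, β₁ ≤ β ∧ coldDefect r.ρ β ⌈T / a β⌉₊ ≤ 1 / 24 := by
      intro G _ _ _ _ hG hsc
      letI : MeasurableSpace G := borel G
      haveI : BorelSpace G := ⟨rfl⟩
      intro r a ha ha0 hlb
      obtain ⟨S, hS, hunif⟩ := hU G hG hsc r a ha ha0 hlb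
      have hev := (Metric.tendstoUniformlyOn_iff.1 hunif) (1 / 24) (by norm_num)
      obtain ⟨T, hT, hT1⟩ := (hev.and (Filter.eventually_ge_atTop 1)).exists
      refine ⟨T, by linarith, fun β₁ => ?_⟩
      obtain ⟨β, hβS, hβ⟩ := hS β₁
      refine ⟨β, hβ, ?_⟩
      have h := hT β hβS
      rw [Real.dist_eq, zero_sub, abs_neg] at h
      exact (le_abs_self _).trans h.le
    exact pinnedExitsCofinalAt24_iff_rateForm.1 (pinnedExitsCofinalAt24_iff_designated.2 hD)

end Summit.QuantumFields.YangMills.Cruxes.IR.PinnedExit96.RateForm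

end
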